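import Literature.AnabelianGeometry.EtaleTheta.Discharge.Sec4NonVacuityCovering
import HarnessLib

/-!
# [EtTh] §4 over the Kummer-tower base with an ARBITRARY group of constants `C` (toy data)

S. Mochizuki, *The étale theta function and its Frobenioid-theoretic manifestations*, Publ. RIMS **45**
(2009) [MochizukiEtTh2009], §3 Def. 3.3 / Def. 3.6 (data of a tempered Frobenioid), §4 Def. 4.1 (setting,
PDF p.86), Prop. 4.2 (iv) proof p.90 L14–17 (sub-node L05 `Prop42Sub.UnitRootsUpstairs` of
`plan/L2/SUBDAG-EtTh-Prop42.md`: «the pull-back … of any element `∈ O^×(A_⊙)` … admits an `N`-th root»).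

TOY DATA (abc-iut cell, block F, seat abc-iut-f-130, own-row follow-up on FACT-LIST row F-2798): the
Kummer-tower toy of abc-iut-w5-d063 (`ToyCov`, `Sec4NonVacuityCovering.lean` p427822: base
`D = SingleObj ℕ+`, `Φ = ℚ_{≥0}` with pull-back `×N`) with its constant field `ℂˣ` REPLACED BY AN ARBITRARY
COMMUTATIVE GROUP `C`:
* `B₀ = B₀^Λ := C × (ℚ_{≥0})^gp` ("constant × monomial `c·t^q`"), pull-back `(c, q) ↦ (c, N q)`, divisor map
  the second projection (`ToyCst.fnFunctor`, `ToyCst.divisorMonoids`, `ToyCst.realified`);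
* the tempered Frobenioid `ToyCst.temperedFrobenioid C` (Def. 3.6 (ii) data, everything REAL as in `ToyCov`),
  `A_⊙ := (∗, 0)`, and the §4 setting `ToyCst.biKummerSetting C` through abc-iut-L2-t9's `mkOfModelCanonical`
  (Galois objects := all, `Π^tp_X ↠ Aut_D(∗) = 1`, `(N,H)`-slot := `True`);
* units: `O^×(A) = C` (`ToyCst.coefAut`, `ToyCst.exists_eq_cnstUnitHom`, `ToyCst.unitsToRatFn_injective`), and
  `A` is `μ_N`-saturated as soon as the `N`-torsion of `C` is cyclic of order `N`
  (`ToyCst.isMuSaturated_of_generator`).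
WHY (the sequel `Sec4NonVacuityConstantsUnitRoots.lean`): at `C := ℤˣ = {±1}` every object is
`μ_2`-saturated but `-1` has no square root, so L05 `UnitRootsUpstairs` FAILS for a genuine `N`-th root
(`N = 2`) — the roots-of-constants input of Prop. 4.2 (iv) (GAP-LEDGER G-w4d044-1) is NOT a consequence of
the typed §4 setting data; at `C = ℂˣ` (= `ToyCov`) it holds because `ℂˣ` is divisible.
This file holds DATA only (`def`s are objects: no `Prop`-valued definition, no named fact, no instance) and
REAL clauses about units.  HONEST LIMITS as for `ToyCov`: one base object, trivial [FrdI] vocabularies,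
`Π^tp` trivial over `ℚ̄`, not a curve; consistency ≠ faithfulness; typed ≠ proved.  Nothing here bears
on, or takes a side on, [IUTchIII] Cor. 3.12.
-/

noncomputable section

namespace Literature.AnabelianGeometry.EtaleTheta

open CategoryTheory Opposite Literature.AlgebraicGeometry.Frobenioids
open scoped NNRat

namespace ToyCst

open ToyCov (Base pt deg cover hom_eq aut_eq_one powFunctor catVocab)

variable (C : Type) [CommGroup C]

/-! ## The data `Φ₀ = ℚ_{≥0}`, `B₀ = C × (ℚ_{≥0})^gp` over the Kummer-tower base -/

/-- `B₀(∗) = B₀^Λ(∗)`: constants times monomials, `C × (ℚ_{≥0})^gp`. [cite: MochizukiEtTh2009, Def 3.3 p.73] -/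
abbrev Fn : Type := C × Algebra.GrothendieckGroup (Multiplicative ℚ≥0)

/-- `B₀` as a functor: pull-back along a morphism of degree `N` is `(c, q) ↦ (c, N q)` (constants stay
constant, `t ↦ t^N`). [cite: MochizukiEtTh2009, Def 3.3 p.73] -/
def fnFunctor : Baseᵒᵖ ⥤ CommMonCat.{0} where
  obj _ := CommMonCat.of (Fn C)
  map f := CommMonCat.ofHom (MonoidHom.prodMap (MonoidHom.id C) (powMonoidHom ((deg f.unop : ℕ+) : ℕ)))
  map_id A := by
    apply CommMonCat.hom_ext
    ext x
    · rfl
    · change x.2 ^ ((1 : ℕ+) : ℕ) = x.2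
      rw [PNat.one_coe, pow_one]
  map_comp f g := by
    apply CommMonCat.hom_ext
    ext x
    · rfl
    · change x.2 ^ ((deg f.unop * deg g.unop : ℕ+) : ℕ) = (x.2 ^ (deg f.unop : ℕ)) ^ (deg g.unop : ℕ)
      rw [PNat.mul_coe, pow_mul]

/-- Pull-back in `B₀` along `f`. [cite: MochizukiEtTh2009, Def 3.3 p.73] -/
@[simp] theorem fnFunctor_map_apply {A B : Baseᵒᵖ} (f : A ⟶ B) (x : Fn C) :
    ((fnFunctor C).map f).hom x = (x.1, x.2 ^ ((deg f.unop : ℕ+) : ℕ)) := rfl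

/-- On groupifications the `N`-th power map induces the `N`-th power map. [folklore] -/
private theorem gpMap_powMonoidHom (M : Type) [CommMonoid M] (N : ℕ) :
    gpMap (powMonoidHom N : M →* M) = powMonoidHom N := by
  apply Algebra.GrothendieckGroup.lift.symm.injective
  rw [Algebra.GrothendieckGroup.lift_symm_apply, Algebra.GrothendieckGroup.lift_symm_apply]
  ext m
  change gpMap (powMonoidHom N) (Algebra.GrothendieckGroup.of m) = Algebra.GrothendieckGroup.of m ^ N
  rw [gpMap_of, powMonoidHom_apply, map_pow]

/-- **Def 3.3 (iii) data with constants `C`**: `Φ₀ = ℚ_{≥0}`, `B₀ = C × (ℚ_{≥0})^gp`, divisor map the second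
projection, `F₀ = B₀`, everything non-cuspidal. [cite: MochizukiEtTh2009, Def 3.3 p.73] -/
def divisorMonoids : DivisorMonoids.{0, 0, 0} Base where
  Φ₀ := powFunctor (Multiplicative ℚ≥0)
  B₀ := fnFunctor C
  isUnit_B₀ _ b := by
    change IsUnit (M := Fn C) b
    exact Group.isUnit _
  div₀ _ := MonoidHom.snd _ _
  div₀_natural f b := by
    change b.2 ^ ((deg f.unop : ℕ+) : ℕ) =
      gpMap (powMonoidHom ((deg f.unop : ℕ+) : ℕ) : Multiplicative ℚ≥0 →* Multiplicative ℚ≥0) b.2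
    rw [gpMap_powMonoidHom]
    rfl
  F₀ _ := ⊤
  F₀_map _ _ _ := trivial
  ncsp₀ _ := ⊤
  csp₀ _ := ⊥
  ncsp₀_map _ _ _ := trivial
  csp₀_map f x hx := by
    rw [Submonoid.mem_bot] at hx ⊢
    rw [hx, map_one]
  existsUnique_ncsp_csp _ x := by
    refine ⟨(⟨x, trivial⟩, ⟨1, Submonoid.mem_bot.mpr rfl⟩), mul_one x, ?_⟩
    rintro ⟨a, c⟩ h
    have hc : c.1 = 1 := Submonoid.mem_bot.mp c.2
    have ha : a.1 = x := by
      have h' : a.1 * c.1 = x := h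
      rwa [hc, mul_one] at h'
    exact Prod.ext (Subtype.ext ha) (Subtype.ext hc)

/-- **Def 3.6 (i) data with constants `C`** (`Λ = ℤ`, `Φ₀^ℝ = Φ₀`, `B₀^Λ = B₀`, `F₀^Λ = B₀`, `ℝ·Φ₀^cnst =`
everything), over the trivial monoid vocabulary. [cite: MochizukiEtTh2009, Def 3.6 p.76] -/
def realified : RealifiedDivisorMonoids (D₀ := Base) Toy.monoidVocab where
  toDivisorMonoids := divisorMonoids C
  Λ := MonoidType.Z
  ΦR := powFunctor (Multiplicative ℚ≥0)
  toR _ := MonoidHom.id _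
  toR_natural _ _ := rfl
  isRealification _ := trivial
  BΛ := fnFunctor C
  isUnit_BΛ _ b := by
    change IsUnit (M := Fn C) b
    exact Group.isUnit _
  divΛ _ := MonoidHom.snd _ _
  divΛ_natural f b := by
    change b.2 ^ ((deg f.unop : ℕ+) : ℕ) =
      gpMap (powMonoidHom ((deg f.unop : ℕ+) : ℕ) : Multiplicative ℚ≥0 →* Multiplicative ℚ≥0) b.2
    rw [gpMap_powMonoidHom]
    rfl
  FΛ _ := ⊤
  FΛ_map _ _ _ := trivial
  cnstR _ := ⊤
  cnstR_map _ _ _ := trivial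
  divΛ_mem_cnstR _ _ _ := trivial
  cnstR_root _ _ _ _ := trivial
  cnst_le_cnstR _ _ _ := trivial
  ncspR _ := ⊤
  cspR _ := ⊥
  toR_ncsp _ _ _ := trivial
  toR_csp _ _ hx := hx

/-- **Def 3.6 (ii), the tempered Frobenioid of the toy with constants `C`**: `D → D₀` the identity,
`Φ = Φ^{ℝ-log} = ℚ_{≥0}` (group-saturated, perfect), `Φ^{bs-fld} = ℚ_{≥0}` monoprime (REAL), and
`t = (1, 𝔭) ∈ F` has divisor `𝔭 ≠ 0` (condition (b), REAL). [cite: MochizukiEtTh2009, Def 3.6 p.77] -/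
def temperedFrobenioid : TemperedFrobenioid (realified C) Base catVocab where
  isConnected := zigzag_isConnected fun j₁ j₂ => by rw [Subsingleton.elim j₁ j₂]
  isTotallyEpimorphic := ⟨fun f => ToyCov.epi _ _ f⟩
  base := 𝟭 _
  Φ := ⟨fun _ => ⊤, fun _ _ _ => trivial⟩
  isGroupSaturated A := (isGroupSaturated_iff' _).2 fun _ _ _ _ _ _ => trivial
  isPerfFactorial _ := trivial
  isDivisorialOn := trivial
  isMonoprime_bsFld A := Toy.isMonoprime_of_eq_top_nnrat
    (eq_top_iff.2 fun x _ => Submonoid.mem_inf.2 ⟨Submonoid.mem_top x,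
      (Subgroup.mem_top (Algebra.GrothendieckGroup.of x) :
        Algebra.GrothendieckGroup.of x ∈
          (⊤ : Subgroup (Algebra.GrothendieckGroup (Multiplicative ℚ≥0))))⟩)
  exists_FΛ_div_ne A := ⟨((1 : C), Algebra.GrothendieckGroup.of (Multiplicative.ofAdd (1 : ℚ≥0))), trivial,
    (Multiplicative.ofAdd (1 : ℚ≥0) : Multiplicative ℚ≥0), trivial, (1 : Multiplicative ℚ≥0), trivial,
    fun h => one_ne_zero (Multiplicative.ofAdd.injective h), by
      change Algebra.GrothendieckGroup.of (M := Multiplicative ℚ≥0) (Multiplicative.ofAdd 1) =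
        Algebra.GrothendieckGroup.of (M := Multiplicative ℚ≥0) (Multiplicative.ofAdd 1) /
          Algebra.GrothendieckGroup.of (M := Multiplicative ℚ≥0) 1
      rw [(Algebra.GrothendieckGroup.of (M := Multiplicative ℚ≥0)).map_one, div_one]⟩

/-- "whose monoid type is `ℤ`". [cite: MochizukiEtTh2009, Def 4.1 p.86] -/
theorem temperedFrobenioid_monoidType : (temperedFrobenioid C).monoidType = MonoidType.Z := rfl

/-- "whose divisor monoid `Φ` is perfect": `Φ(A) = ℚ_{≥0}`. [cite: MochizukiEtTh2009, Def 4.1 p.86] -/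
theorem temperedFrobenioid_isPerfect (A : Baseᵒᵖ) : IsPerfect ((temperedFrobenioid C).Φ.carrier A) :=
  isPerfect_of_mulEquiv_nnrat (N := ↥(⊤ : Submonoid (Multiplicative ℚ≥0))) Submonoid.topEquiv

/-- `B` is objectwise group-like. [cite: MochizukiEtTh2009, Def 3.6 p.77] -/
theorem ratFnFunctor_isGroupLike :
    Objectwise (fun M _ => IsGroupLike M) (temperedFrobenioid C).ratFnFunctor :=
  (temperedFrobenioid C).ratFnFunctor_isGroupLike (realified C).isUnit_BΛ

/-- `Φ = ℚ_{≥0}` is objectwise divisorial (monoprime). [cite: MochizukiEtTh2009, Def 3.6 p.77] -/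
theorem divisorMonoid_isDivisorial :
    Objectwise (fun M _ => IsDivisorial M) (temperedFrobenioid C).divisorMonoid :=
  fun _ => (Toy.isMonoprime_of_eq_top_nnrat (S := (⊤ : Submonoid (Multiplicative ℚ≥0))) rfl).isDivisorial

/-! ## The §4 setting with constants `C` -/

/-- `A_⊙ := (∗, 0)`. [cite: MochizukiEtTh2009, Def 4.1 p.86] -/
def Aodot : (temperedFrobenioid C).category :=
  ModelFrobenioid.zeroObj _ _ _ pt

/-- `A_⊙` is Frobenius-trivial (L1's [FrdI] Thm 5.2 proof step). [cite: MochizukiEtTh2009, Def 4.1 p.86] -/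
theorem isFrobeniusTrivial_Aodot :
    PreFrobenioid.IsFrobeniusTrivial (temperedFrobenioid C).toElem (Aodot C) :=
  ModelFrobenioid.isFrobeniusTrivial_zeroObj (ratFnFunctor_isGroupLike C) _

/-- **The §4 setting with constants `C`**: the `BiKummerSetting` over the toy tempered Frobenioid, through
abc-iut-L2-t9's canonical model constructor `mkOfModelCanonical` (Galois objects := all,
`Π^tp_X ↠ Aut_D(A^bs)` := trivial, `(N,H)`-slot := `True`, `A_⊙ := (∗, 0)`). [cite: MochizukiEtTh2009, Def 4.1 p.86] -/
def biKummerSetting : BiKummerSetting Toy.temperedGroup (realified C) Base catVocab :=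
  BiKummerSetting.mkOfModelCanonical Toy.temperedGroup (temperedFrobenioid C) (temperedFrobenioid_monoidType C)
    (temperedFrobenioid_isPerfect C) (fun _ => True) (fun _ _ => 1) ToyCov.galoisSurj_surjective
    (fun _ _ _ => True) (Aodot C) (isFrobeniusTrivial_Aodot C) trivial

/-! ## Units: `O^×(A) = C` -/

section Units

variable {C} (A : (temperedFrobenioid C).category)

/-- Every automorphism of an object of the toy Frobenioid with constants `C` is a unit (`Aut_C(A) = O^×(A)`):
its base part is an automorphism of `∗`, hence `1`, and isomorphisms have Frobenius degree `1`.
[cite: MochizukiFrdI2008, Thm. 5.2(ii) p.101] -/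
theorem mem_units (σ : Aut A) : σ ∈ (temperedFrobenioid C).units A := by
  refine ⟨?_, (ModelFrobenioid.degFr_hom_eq_one σ).1⟩
  have h : ModelFrobenioid.baseMap σ.hom ≫ ModelFrobenioid.baseMap σ.inv = 𝟙 _ := by
    rw [← ModelFrobenioid.baseMap_comp, σ.hom_inv_id, ModelFrobenioid.baseMap_id]
  have h1 : (deg (ModelFrobenioid.baseMap σ.inv) : ℕ) * (deg (ModelFrobenioid.baseMap σ.hom) : ℕ) = 1 := by
    exact_mod_cast congrArg (fun x : ℕ+ => (x : ℕ))
      (h : deg (ModelFrobenioid.baseMap σ.inv) * deg (ModelFrobenioid.baseMap σ.hom) = 1)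
  exact hom_eq (PNat.coe_eq_one_iff.mp (Nat.eq_one_of_mul_eq_one_left h1))

/-- The constant `c ∈ C` as a rational function on `A^bs` (divisor `0`). [cite: MochizukiEtTh2009, Def 3.6 p.77] -/
def cnst (c : C) : (temperedFrobenioid C).ratFnFunctor.obj (op A.base) :=
  ⟨(((c, 1) : Fn C), 1), by
    change (1 : Algebra.GrothendieckGroup (Multiplicative ℚ≥0)) = (temperedFrobenioid C).ΦgpToRlog _ 1
    exact (map_one _).symm⟩

/-- Pull-back of a constant along any base arrow is the same constant. [cite: MochizukiEtTh2009, Def 3.6 p.77] -/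
theorem pull_cnst {A' : (temperedFrobenioid C).category} (b : A'.base ⟶ A.base) (c : C) :
    pull (temperedFrobenioid C).ratFnFunctor b (cnst A c) = cnst A' c := by
  apply Subtype.ext
  change (((fnFunctor C).map ((temperedFrobenioid C).base.map b).op).hom ((c, 1) : Fn C),
      gpMap ((temperedFrobenioid C).Φ.pull b.op) 1) = (((c, 1) : Fn C), 1)
  rw [fnFunctor_map_apply, one_pow, map_one]
  rfl

/-- The constants as a homomorphism `C → B(A^bs)^×`. [cite: MochizukiEtTh2009, Def 3.6 p.77] -/
def cnstUnitHom : C →* ((temperedFrobenioid C).ratFnFunctor.obj (op A.base))ˣ where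
  toFun c := ⟨cnst A c, cnst A c⁻¹,
    Subtype.ext (Prod.ext (Prod.ext (mul_inv_cancel c) (mul_one _)) (mul_one _)),
    Subtype.ext (Prod.ext (Prod.ext (inv_mul_cancel c) (mul_one _)) (mul_one _))⟩
  map_one' := Units.ext (Subtype.ext rfl)
  map_mul' _ _ := Units.ext (Subtype.ext (Prod.ext (Prod.ext rfl (mul_one _).symm) (mul_one _).symm))

/-- `cnstUnitHom c` is the constant `c` as a rational function. [cite: MochizukiEtTh2009, Def 3.6 p.77] -/
@[simp] theorem coe_cnstUnitHom (c : C) :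
    ((cnstUnitHom A c : ((temperedFrobenioid C).ratFnFunctor.obj (op A.base))ˣ) :
      (temperedFrobenioid C).ratFnFunctor.obj (op A.base)) = cnst A c := rfl

/-- `cnstUnitHom` is injective (constants embed in `B(A^bs)^×`). [cite: MochizukiFrdI2008, Thm. 5.2(ii) p.101] -/
theorem cnstUnitHom_injective : Function.Injective (cnstUnitHom A) := fun _ _ h =>
  congrArg (fun u : ((temperedFrobenioid C).ratFnFunctor.obj (op A.base))ˣ =>
    (u : (temperedFrobenioid C).ratFnFunctor.obj (op A.base)).1.1.1) h

/-- `0 = Div_B(c)` for a constant. [cite: MochizukiFrdI2008, Thm. 5.2(i) p.100] -/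
theorem of_one_eq_divB_cnst (c : C) :
    Algebra.GrothendieckGroup.of (1 : (temperedFrobenioid C).divisorMonoid.obj (op A.base)) =
      divB (temperedFrobenioid C).divisorMonoid (temperedFrobenioid C).ratFnFunctor
        (temperedFrobenioid C).divBNatTrans (op A.base) (cnst A c) := by
  rw [map_one]
  rfl

/-- **"Multiplication by the constant `c`"**: the unit automorphism `(1, id, 0, c) ∈ O^×(A)` (L1's
`ModelFrobenioid.unitAut`). [cite: MochizukiFrdI2008, Thm. 5.2(ii) p.101] -/
def coefAut (c : C) : Aut A :=
  ModelFrobenioid.unitAut A 1 1 (cnst A c) (cnst A c⁻¹) (of_one_eq_divB_cnst A c) (of_one_eq_divB_cnst A c⁻¹)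
    (one_mul 1) (Subtype.ext (Prod.ext (Prod.ext (inv_mul_cancel c) (mul_one _)) (mul_one _)))

/-- `coefAut c ∈ O^×(A)`. [cite: MochizukiFrdI2008, Thm. 5.2(ii) p.101] -/
theorem coefAut_mem_units (c : C) : coefAut A c ∈ ModelFrobenioid.units A :=
  ModelFrobenioid.unitAut_mem_units _ _ _ _ _ _ _ _ _

/-- The rational function of `coefAut c` is the constant `c`. [cite: MochizukiFrdI2008, Thm. 5.2(ii) p.101] -/
@[simp] theorem unit_coefAut_hom (c : C) : ModelFrobenioid.unit (coefAut A c).hom = cnst A c := rfl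

/-- `coefAut c` as an element of `O^×(A)`. [cite: MochizukiFrdI2008, Thm. 5.2(ii) p.101] -/
def coefUnit (c : C) : ModelFrobenioid.units A := ⟨coefAut A c, coefAut_mem_units A c⟩

/-- Under `O^×(A) ↪ B(A^bs)^×` ([FrdI] Thm 5.2 (ii)) `coefAut c ↦ c`. [cite: MochizukiFrdI2008, Thm. 5.2(ii) p.101] -/
theorem unitsToRatFn_coefUnit (c : C) :
    ModelFrobenioid.unitsToRatFn A (coefUnit A c) = cnstUnitHom A c :=
  Units.ext rfl

/-- **`O^×(A) = C`**: every unit of `A` is multiplication by a constant — its rational function `u` has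
`Div_B(u) = 0` (`Φ` sharp), hence monomial part `0`. [cite: MochizukiFrdI2008, Thm. 5.2(ii) p.101] -/
theorem exists_eq_cnstUnitHom (τ : ModelFrobenioid.units A) :
    ∃ c : C, ModelFrobenioid.unitsToRatFn A τ = cnstUnitHom A c := by
  have h2 : (ModelFrobenioid.unitsToRatFn A τ : (temperedFrobenioid C).ratFnFunctor.obj (op A.base)).1.2 = 1 :=
    ModelFrobenioid.divB_unitsToRatFn_eq_one (divisorMonoid_isDivisorial C A.base).isSharp τ
  have h12 : (ModelFrobenioid.unitsToRatFn A τ :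
      (temperedFrobenioid C).ratFnFunctor.obj (op A.base)).1.1.2 = 1 := by
    have hrel := (ModelFrobenioid.unitsToRatFn A τ : (temperedFrobenioid C).ratFnFunctor.obj (op A.base)).2
    change (_ : Algebra.GrothendieckGroup (Multiplicative ℚ≥0)) = (temperedFrobenioid C).ΦgpToRlog _ _ at hrel
    rw [h2, map_one] at hrel
    exact hrel
  exact ⟨(ModelFrobenioid.unitsToRatFn A τ : (temperedFrobenioid C).ratFnFunctor.obj (op A.base)).1.1.1,
    Units.ext (Subtype.ext (Prod.ext (Prod.ext rfl h12) h2))⟩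

/-- `O^×(A) ↪ B(A^bs)^×` is injective at the toy with constants `C` (`Φ = ℚ_{≥0}` integral).
[cite: MochizukiFrdI2008, Thm. 5.2(ii) p.101] -/
theorem unitsToRatFn_injective :
    ∀ τ₁ τ₂ : ModelFrobenioid.units A,
      ModelFrobenioid.unitsToRatFn A τ₁ = ModelFrobenioid.unitsToRatFn A τ₂ → τ₁ = τ₂ :=
  fun _ _ h =>
    ModelFrobenioid.unitsToRatFn_injective (divisorMonoid_isDivisorial C A.base).isPreDivisorial.isIntegral h

/-- Every unit of `A` is `coefAut c` for some constant `c ∈ C`. [cite: MochizukiFrdI2008, Thm. 5.2(ii) p.101] -/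
theorem exists_eq_coefAut {σ : Aut A} (hσ : σ ∈ ModelFrobenioid.units A) : ∃ c : C, σ = coefAut A c := by
  obtain ⟨c, hc⟩ := exists_eq_cnstUnitHom A ⟨σ, hσ⟩
  refine ⟨c, ?_⟩
  have h : (⟨σ, hσ⟩ : ModelFrobenioid.units A) = coefUnit A c :=
    unitsToRatFn_injective A _ _ (hc.trans (unitsToRatFn_coefUnit A c).symm)
  exact congrArg Subtype.val h

/-- **`μ_N`-saturation from a generator of the `N`-torsion of `C`** (REAL [FrdII] Def 2.1 (i)): if
`ζ ∈ C` has order `N` and every `c ∈ C` with `c^N = 1` is a power of `ζ`, then `μ_N(A) = ⟨coefAut ζ⟩` is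
cyclic of order `N` for every object `A`. [cite: MochizukiEtTh2009, Def 4.1 p.87] -/
theorem isMuSaturated_of_generator (N : ℕ+) (ζ : C) (hζ : orderOf ζ = (N : ℕ))
    (hgen : ∀ c : C, c ^ (N : ℕ) = 1 → c ∈ Subgroup.zpowers ζ) :
    (temperedFrobenioid C).IsMuSaturated A N := by
  have hinj := unitsToRatFn_injective A
  have hord : orderOf (coefUnit A ζ) = (N : ℕ) := by
    rw [← orderOf_injective _ hinj (coefUnit A ζ), unitsToRatFn_coefUnit,
      orderOf_injective _ (cnstUnitHom_injective A) ζ]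
    exact hζ
  refine ⟨(coefUnit A ζ : Aut A), ⟨⟨(coefAut_mem_units A ζ).1, (coefAut_mem_units A ζ).2⟩, ?_⟩, ?_, ?_⟩
  · have h := congrArg Subtype.val (pow_orderOf_eq_one (coefUnit A ζ))
    rwa [hord, SubmonoidClass.coe_pow] at h
  · rw [show (coefUnit A ζ : Aut A) = ((coefUnit A ζ : ModelFrobenioid.units A) : Aut A) from rfl,
      Subgroup.orderOf_coe, hord]
  · rintro τ ⟨hτu, hτN⟩
    let τu : ModelFrobenioid.units A := ⟨τ, hτu.1, hτu.2⟩
    obtain ⟨c, hc⟩ := exists_eq_cnstUnitHom A τu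
    have hτuN : τu ^ (N : ℕ) = 1 := Subtype.ext (by rw [SubmonoidClass.coe_pow]; exact hτN)
    have hcN : c ^ (N : ℕ) = 1 := cnstUnitHom_injective A (by
      rw [map_pow, ← hc, ← map_pow, hτuN, map_one, map_one])
    obtain ⟨i, hi⟩ := Subgroup.mem_zpowers_iff.mp (hgen c hcN)
    have hτu' : (coefUnit A ζ) ^ i = τu :=
      hinj _ _ (by rw [map_zpow, unitsToRatFn_coefUnit, ← map_zpow, hi, hc])
    exact Subgroup.mem_zpowers_iff.mpr ⟨i, by
      have h := congrArg Subtype.val hτu'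
      rwa [SubgroupClass.coe_zpow] at h⟩

end Units

/-- **`O^×(A_⊙) = Aut_C(A_⊙) = C` at the setting with constants `C`**: every automorphism of `A_⊙` is
multiplication by a constant. [cite: MochizukiEtTh2009, Def 4.1 p.87] -/
theorem exists_eq_coefAut_Aodot (σ : Aut (biKummerSetting C).Aodot) : ∃ c : C, σ = coefAut (Aodot C) c :=
  exists_eq_coefAut (Aodot C) ⟨(mem_units (Aodot C) σ).1, (mem_units (Aodot C) σ).2⟩

end ToyCst

end Literature.AnabelianGeometry.EtaleTheta

end
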